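import Summits.QuantumFields.YangMills.Theorems.AtomicCalibrationRAtomCeilingsTransport
import Summits.QuantumFields.YangMills.Theorems.OnsetTautologyOnsetContraction
import HarnessLib

/-!
# E1 `stub_atomCeiling` of LINES «AtomicEngine» / «MirrorCalibration» on crux ⟨stmt-QuantumFields-28169⟩ — part 2/2:
# `OnsetContraction → AtomCeilings` BY NAME

Author of the mathematics and of the Lean proof: planner **ym-idea-11 g15** (HOME `ideators/ym-idea-11/g15/bc/e1_atomCeilings.lean`,
sha 06962753, verified by idea-crit-9 ACK #86d); landed unchanged (split at the 400-line cap, §0/§1 currency defs replaced by the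
import of `Theorems/AtomicCalibrationRMirrorCalibrationDefs.lean` = critic price #86 P2) by the LEAD seat ym-line-sfw-p2 g74 as a
landing service.

Content of part 2: `core_below` (an atom BELOW the mirror is the time-mirror image of an admissible atom ABOVE it:
`Θ`-invariance of odd-torus limit states + the profile's time symmetry), `core_zero`, the axis transposition `(0 k)`
(`stateMomentStr_configPermZd` + the profile's permutation symmetry: `sitePermZd_swap_reflSite`, `atomWt_perm`, `M2_swap`),
`core_axis`, and the registered stub **`stub_atomCeiling : OnsetContraction → AtomCeilings`** (= `atomCeiling_proof`).
Since `OnsetContraction` (28128) is ledger-closed (`onsetContraction_proof`), `AtomCeilings` holds outright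
(`atomCeilings_holds`).

HONEST LABEL: lattice-symmetry plumbing around the onset DEFINITION; nothing here is a β-uniform bound, nothing bears
on NT / UV / IR, no crux, rung, leaf or summit is proved, and the Yang–Mills mass gap is NOT proved.
-/

set_option autoImplicit false

noncomputable section

open scoped BigOperators
open MeasureTheory Filter Topology
open Literature.MathematicalPhysics.QuantumFieldTheory Literature.MathematicalPhysics.QuantumLattice
open Literature.Probability.LatticeModels (Site)
open Summit.QuantumFields.YangMills.Theorems.InfiniteVolume (stateMomentStr stateMomentStr_configPermZd
  stateMomentStr_reflSite stateMomentStr_translate_of_mem_oddTorusLimitPoints plane_configPermZd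
  single_add_single_permPlane)
open Summit.QuantumFields.YangMills.Theorems.InfVolRP (centreOffset centreOffset_time two_mul_centreOffset_zero
  reflSite_apply_zero reflSite_apply_of_ne smul_reflSite_add_of_centre
  mem_infiniteVolumeLimitPoints_of_mem_oddTorusLimitPoints)
open Summit.QuantumFields.YangMills.Theorems.OSLegsFromFemtoAndGap (permPlane permPlane_valid)
open Summit.QuantumFields.GaugeBoot (map_configPermZd_eq_of_mem_infiniteVolumeLimitPoints
  map_configSiteReflect_zero_eq_of_mem_infiniteVolumeLimitPoints)
open Summit.QuantumFields.YangMills.Theses.OnsetTautology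

namespace Summit.QuantumFields.YangMills.Cruxes.AtomicCalibrationR.MirrorCalibration

variable {G : Type} [Group G] [TopologicalSpace G] [IsTopologicalGroup G] [CompactSpace G]
  [MeasurableSpace G] [BorelSpace G]

/-- **Core (below).**  Mirror `x₀ = c`, every carrier site at `x₀ + t/s + 2 ≤ c`: reflect state and profile in time
and apply `core_above` to the mirrored atom (which sits at `x₀ ≥ c + t/s + 1`). -/
theorem core_below [T2Space G] [SecondCountableTopology G] (r : LatticeRep G) {β : ℝ} {μ : Measure (LGConfig 4 G)}
    (hμ : μ ∈ oddTorusLimitPoints r β) (b : SchwartzMap (EuclideanSpace ℝ (Fin 4)) ℝ) (hcon : Contracts r μ b)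
    {T : ℝ} (hT : ∀ u : EuclideanSpace ℝ (Fin 4), b (WithLp.toLp 2 fun i => if i = 0 then T - u i else u i) = b u)
    (ε A : ℝ) (hε : 0 < ε) (hA : ∀ s ∈ onsetSet r μ b ε, s ≤ A) (S : Finset ((Fin 4 × Fin 4) × (Fin 4 → ℤ)))
    (q : Fin 4 × Fin 4) (s t : ℝ) (y : EuclideanSpace ℝ (Fin 4)) (c : ℤ) (hs : 0 < s) (hAs : A < s)
    (ht : ∀ u, b u ≠ 0 → ‖u‖ ≤ t) (hS : ∀ p, atomWt b {q} s y p ≠ 0 → p ∈ S)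
    (hside : ∀ p ∈ S, ((p.2 0 : ℤ) : ℝ) + t / s + 2 ≤ (c : ℝ)) :
    ∑ p ∈ S, ∑ p' ∈ S, atomWt b {q} s y p * atomWt b {q} s y p' *
        stateMomentStr G r μ 2 ![p.1, p'.1] ![reflSite 0 c p, p'.2] ≤ ε := by
  classical
  -- Step 1: only plaquettes with non-zero weight matter
  have hmem₀ : ∀ p, p ∈ S.filter (fun p => atomWt b {q} s y p ≠ 0) ↔ p ∈ S ∧ atomWt b {q} s y p ≠ 0 :=
    fun p => Finset.mem_filter
  rw [← Finset.sum_filter_of_ne (s := S) (p := fun p => atomWt b {q} s y p ≠ 0) (fun p _ hne h0 =>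
    hne (Finset.sum_eq_zero fun p' _ => by rw [h0, zero_mul, zero_mul]))]
  rw [Finset.sum_congr rfl fun p _ => (Finset.sum_filter_of_ne (s := S) (p := fun p' => atomWt b {q} s y p' ≠ 0)
    (f := fun p' => atomWt b {q} s y p * atomWt b {q} s y p' * stateMomentStr G r μ 2 ![p.1, p'.1]
      ![reflSite 0 c p, p'.2]) (fun p' _ hne h0 => hne (by rw [h0, mul_zero, zero_mul]))).symm]
  -- Step 2: re-index by the mirror `hat`
  let hat : (Fin 4 × Fin 4) × (Fin 4 → ℤ) → (Fin 4 × Fin 4) × (Fin 4 → ℤ) := fun p => (p.1, reflSite 0 c p)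
  have hhat : ∀ p, hat (hat p) = p := fun p => Prod.ext rfl (reflSite_zero_invol c p)
  have hinj : Set.InjOn hat ↑(S.filter fun p => atomWt b {q} s y p ≠ 0) := fun p _ p' _ h => by
    have h' := congrArg hat h
    rwa [hhat, hhat] at h'
  have hyh : y + (2 * s * c - 2 * y 0 - T) • EuclideanSpace.single 0 (1 : ℝ) =
      y + (2 * s * c - 2 * y 0 - T) • EuclideanSpace.single 0 (1 : ℝ) := rfl
  have key := core_above r hμ b hcon ε A hε hA ((S.filter fun p => atomWt b {q} s y p ≠ 0).image hat) q s t
    (y + (2 * s * c - 2 * y 0 - T) • EuclideanSpace.single 0 (1 : ℝ)) c hs hAs ht ?_ ?_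
  · rw [Finset.sum_image hinj] at key
    refine le_of_eq_of_le (Finset.sum_congr rfl fun p hp => ?_) key
    rw [Finset.sum_image hinj]
    refine Finset.sum_congr rfl fun p' hp' => ?_
    have hv : p.1.1 < p.1.2 := ((atomWt_ne_zero_iff_flat b {q} s y p).1 ((hmem₀ p).1 hp).2).2.1
    have hv' : p'.1.1 < p'.1.2 := ((atomWt_ne_zero_iff_flat b {q} s y p').1 ((hmem₀ p').1 hp').2).2.1
    dsimp only [hat]
    rw [atomWt_hat hT {q} s y c _ hyh, atomWt_hat hT {q} s y c _ hyh]
    dsimp only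
    rw [reflSite_zero_invol, reflSite_zero_invol, Prod.mk.eta, Prod.mk.eta, M2_reflect_swap r hμ p p' hv hv' c]
  · -- carrier of the mirrored atom
    intro ph hph
    rw [atomWt_hat hT {q} s y c _ hyh] at hph
    rw [Finset.mem_image]
    exact ⟨(ph.1, reflSite 0 c ph), (hmem₀ _).2 ⟨hS _ hph, hph⟩, Prod.ext rfl (reflSite_zero_invol c ph)⟩
  · -- the mirrored atom sits at `x₀ ≥ c + t/s + 1`
    intro ph hph
    rw [Finset.mem_image] at hph
    obtain ⟨p, hp, rfl⟩ := hph
    have hsd := hside p ((hmem₀ p).1 hp).1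
    show (c : ℝ) + t / s ≤ ((reflSite 0 c p 0 : ℤ) : ℝ)
    simp only [reflSite, if_true]
    split_ifs <;> push_cast <;> linarith

/-- **Core (axis 0).**  Both sides of the mirror `x₀ = c`. -/
theorem core_zero [T2Space G] [SecondCountableTopology G] (r : LatticeRep G) {β : ℝ} {μ : Measure (LGConfig 4 G)}
    (hμ : μ ∈ oddTorusLimitPoints r β) (b : SchwartzMap (EuclideanSpace ℝ (Fin 4)) ℝ) (hcon : Contracts r μ b)
    {T : ℝ} (hT : ∀ u : EuclideanSpace ℝ (Fin 4), b (WithLp.toLp 2 fun i => if i = 0 then T - u i else u i) = b u)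
    (ε A : ℝ) (hε : 0 < ε) (hA : ∀ s ∈ onsetSet r μ b ε, s ≤ A) (S : Finset ((Fin 4 × Fin 4) × (Fin 4 → ℤ)))
    (q : Fin 4 × Fin 4) (s t : ℝ) (y : EuclideanSpace ℝ (Fin 4)) (c : ℤ) (hs : 0 < s) (hAs : A < s)
    (ht : ∀ u, b u ≠ 0 → ‖u‖ ≤ t) (hS : ∀ p, atomWt b {q} s y p ≠ 0 → p ∈ S)
    (hside : (∀ p ∈ S, ((p.2 0 : ℤ) : ℝ) + t / s + 2 ≤ (c : ℝ)) ∨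
      (∀ p ∈ S, (c : ℝ) + t / s + 2 ≤ ((p.2 0 : ℤ) : ℝ))) :
    ∑ p ∈ S, ∑ p' ∈ S, atomWt b {q} s y p * atomWt b {q} s y p' *
        stateMomentStr G r μ 2 ![p.1, p'.1] ![reflSite 0 c p, p'.2] ≤ ε :=
  hside.elim (core_below r hμ b hcon hT ε A hε hA S q s t y c hs hAs ht hS) fun h =>
    core_above r hμ b hcon ε A hε hA S q s t y c hs hAs ht hS fun p hp => by linarith [h p hp]

/-! ## §C Axis `k ≠ 0`: the transposition `(0 k)` of the state and of the profile -/

omit [Group G] [TopologicalSpace G] [IsTopologicalGroup G] [CompactSpace G] [MeasurableSpace G] [BorelSpace G] in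
/-- A plaquette has a leg along `k` iff its `(0 k)`-transposed (re-sorted) orientation has a leg along `0`. -/
theorem permPlane_swap_hasLeg (k : Fin 4) (q : Fin 4 × Fin 4) :
    ((permPlane (Equiv.swap 0 k) q).1 = 0 ∨ (permPlane (Equiv.swap 0 k) q).2 = 0) ↔ (q.1 = k ∨ q.2 = k) := by
  have e : ∀ j : Fin 4, (Equiv.swap (0 : Fin 4) k) j = 0 ↔ j = k := fun j => by
    rw [Equiv.swap_apply_eq_iff, Equiv.swap_apply_left]
  unfold permPlane
  split_ifs
  · show ((Equiv.swap 0 k) q.1 = 0 ∨ (Equiv.swap 0 k) q.2 = 0) ↔ _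
    rw [e, e]
  · show ((Equiv.swap 0 k) q.2 = 0 ∨ (Equiv.swap 0 k) q.1 = 0) ↔ _
    rw [e, e, or_comm]

omit [Group G] [TopologicalSpace G] [IsTopologicalGroup G] [CompactSpace G] [MeasurableSpace G] [BorelSpace G] in
/-- **The transposed mirror**: `sitePermZd (0 k) (reflSite k c (a, x)) = reflSite 0 c ((0 k)·a, (0 k)·x)`. -/
theorem sitePermZd_swap_reflSite (k : Fin 4) (hk : k ≠ 0) (c : ℤ) (a : Fin 4 × Fin 4) (x : Site 4) :
    sitePermZd (Equiv.swap 0 k) (reflSite k c (a, x)) =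
      reflSite 0 c (permPlane (Equiv.swap 0 k) a, sitePermZd (Equiv.swap 0 k) x) := by
  have h0k : ¬ (0 : Fin 4) = k := fun h => hk h.symm
  funext l
  rw [sitePermZd_apply, Equiv.symm_swap]
  by_cases hl0 : l = 0
  · subst hl0
    rw [Equiv.swap_apply_left]
    simp only [reflSite, if_true, sitePermZd_apply, Equiv.symm_swap, Equiv.swap_apply_left]
    by_cases hq : a.1 = k ∨ a.2 = k
    · rw [if_pos hq, if_pos ((permPlane_swap_hasLeg k a).2 hq)]
    · rw [if_neg hq, if_neg (mt (permPlane_swap_hasLeg k a).1 hq)]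
  · by_cases hlk : l = k
    · subst hlk
      rw [Equiv.swap_apply_right]
      simp only [reflSite, h0k, hl0, if_false, sitePermZd_apply, Equiv.symm_swap, Equiv.swap_apply_right]
    · rw [Equiv.swap_apply_of_ne_of_ne hl0 hlk]
      simp only [reflSite, hlk, hl0, if_false, sitePermZd_apply, Equiv.symm_swap,
        Equiv.swap_apply_of_ne_of_ne hl0 hlk]

omit [Group G] [TopologicalSpace G] [IsTopologicalGroup G] [CompactSpace G] [MeasurableSpace G] [BorelSpace G] in
/-- The site transposition `(0 k)` is an involution. -/
theorem sitePermZd_swap_swap (k : Fin 4) (x : Site 4) :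
    sitePermZd (Equiv.swap 0 k) (sitePermZd (Equiv.swap 0 k) x) = x := by
  funext l
  simp only [sitePermZd_apply, Equiv.symm_swap, Equiv.swap_apply_self]

/-- Two-point centred weights of an odd-torus limit state under the transposition `(0 k)`. -/
theorem M2_swap [T2Space G] [SecondCountableTopology G] (r : LatticeRep G) {β : ℝ} {μ : Measure (LGConfig 4 G)} (hμ : μ ∈ oddTorusLimitPoints r β)
    (k : Fin 4) (a a' : Fin 4 × Fin 4) (x x' : Site 4) :
    stateMomentStr G r μ 2 ![a, a'] ![x, x'] =
      stateMomentStr G r μ 2 ![permPlane (Equiv.swap 0 k) a, permPlane (Equiv.swap 0 k) a']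
        ![sitePermZd (Equiv.swap 0 k) x, sitePermZd (Equiv.swap 0 k) x'] := by
  have hπ := map_configPermZd_eq_of_mem_infiniteVolumeLimitPoints r.ρ r.continuous
    (mem_infiniteVolumeLimitPoints_of_mem_oddTorusLimitPoints r hμ) (Equiv.swap 0 k)
  rw [stateMomentStr_configPermZd r (Equiv.swap 0 k) hπ ![a, a'] ![x, x'], Equiv.symm_swap]
  congr 1
  · funext i; fin_cases i <;> rfl
  · funext i; fin_cases i <;> rfl

omit [Group G] [TopologicalSpace G] [IsTopologicalGroup G] [CompactSpace G] [MeasurableSpace G] [BorelSpace G] in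
/-- Centre offsets of a re-sorted permuted orientation. -/
theorem centreOffset_permPlane_apply (π : Equiv.Perm (Fin 4)) {q : Fin 4 × Fin 4} (hq : q.1 < q.2) (i : Fin 4) :
    centreOffset (permPlane π q) i = centreOffset q (π.symm i) := by
  unfold centreOffset
  rw [if_pos (permPlane_valid π hq), if_pos hq, single_add_single_permPlane]
  simp only [PiLp.smul_apply, PiLp.add_apply, PiLp.single_apply, Equiv.symm_apply_eq]

omit [Group G] [TopologicalSpace G] [IsTopologicalGroup G] [CompactSpace G] [MeasurableSpace G] [BorelSpace G] in
/-- **The transposed atom is an admissible atom**: by the profile's permutation symmetry, the weight of the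
transposed plaquette in the atom `((0 k)·q, s, y ∘ (0 k))` is the weight of the original plaquette. -/
theorem atomWt_perm {b : SchwartzMap (EuclideanSpace ℝ (Fin 4)) ℝ}
    (hperm : ∀ (π : Equiv.Perm (Fin 4)) (u : EuclideanSpace ℝ (Fin 4)), b (WithLp.toLp 2 fun i => u (π i)) = b u)
    (π : Equiv.Perm (Fin 4)) (hπ : π.symm = π) {q : Fin 4 × Fin 4} (hq : q.1 < q.2) (s : ℝ)
    (y yh : EuclideanSpace ℝ (Fin 4)) (hyh : yh = WithLp.toLp 2 fun i => y (π i)) (x : Site 4) :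
    atomWt b {permPlane π q} s yh (permPlane π q, sitePermZd π x) = atomWt b {q} s y (q, x) := by
  unfold atomWt
  dsimp only
  rw [if_pos ⟨Finset.mem_singleton_self _, permPlane_valid π hq⟩, if_pos ⟨Finset.mem_singleton_self _, hq⟩,
    ← hperm π (s • (siteToE x + centreOffset q) - y)]
  congr 1
  ext i
  rw [PiLp.toLp_apply, atomArg_apply, atomArg_apply, hyh, PiLp.toLp_apply, sitePermZd_apply, hπ,
    centreOffset_permPlane_apply π hq, hπ]

/-- **Core (axis `k ≠ 0`).**  Transpose state, orientation, sites and profile by `(0 k)` and apply `core_zero`. -/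
theorem core_axis [T2Space G] [SecondCountableTopology G] (r : LatticeRep G) {β : ℝ} {μ : Measure (LGConfig 4 G)}
    (hμ : μ ∈ oddTorusLimitPoints r β) (b : SchwartzMap (EuclideanSpace ℝ (Fin 4)) ℝ) (hcon : Contracts r μ b)
    {T : ℝ} (hT : ∀ u : EuclideanSpace ℝ (Fin 4), b (WithLp.toLp 2 fun i => if i = 0 then T - u i else u i) = b u)
    (hperm : ∀ (π : Equiv.Perm (Fin 4)) (u : EuclideanSpace ℝ (Fin 4)), b (WithLp.toLp 2 fun i => u (π i)) = b u)
    (ε A : ℝ) (hε : 0 < ε) (hA : ∀ s ∈ onsetSet r μ b ε, s ≤ A) (S : Finset ((Fin 4 × Fin 4) × (Fin 4 → ℤ)))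
    (q : Fin 4 × Fin 4) (s t : ℝ) (y : EuclideanSpace ℝ (Fin 4)) (k : Fin 4) (c : ℤ) (hk : k ≠ 0)
    (hq : q.1 < q.2) (hs : 0 < s) (hAs : A < s) (ht : ∀ u, b u ≠ 0 → ‖u‖ ≤ t)
    (hS : ∀ p, atomWt b {q} s y p ≠ 0 → p ∈ S)
    (hside : (∀ p ∈ S, ((p.2 k : ℤ) : ℝ) + t / s + 2 ≤ (c : ℝ)) ∨
      (∀ p ∈ S, (c : ℝ) + t / s + 2 ≤ ((p.2 k : ℤ) : ℝ))) :
    ∑ p ∈ S, ∑ p' ∈ S, atomWt b {q} s y p * atomWt b {q} s y p' *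
        stateMomentStr G r μ 2 ![p.1, p'.1] ![reflSite k c p, p'.2] ≤ ε := by
  classical
  have hmem₀ : ∀ p, p ∈ S.filter (fun p => atomWt b {q} s y p ≠ 0) ↔ p ∈ S ∧ atomWt b {q} s y p ≠ 0 :=
    fun p => Finset.mem_filter
  have hq₀ : ∀ p ∈ S.filter (fun p => atomWt b {q} s y p ≠ 0), p.1 = q := fun p hp =>
    Finset.mem_singleton.1 ((atomWt_ne_zero_iff_flat b {q} s y p).1 ((hmem₀ p).1 hp).2).1
  -- Step 1: only plaquettes with non-zero weight matter
  rw [← Finset.sum_filter_of_ne (s := S) (p := fun p => atomWt b {q} s y p ≠ 0) (fun p _ hne h0 =>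
    hne (Finset.sum_eq_zero fun p' _ => by rw [h0, zero_mul, zero_mul]))]
  rw [Finset.sum_congr rfl fun p _ => (Finset.sum_filter_of_ne (s := S) (p := fun p' => atomWt b {q} s y p' ≠ 0)
    (f := fun p' => atomWt b {q} s y p * atomWt b {q} s y p' * stateMomentStr G r μ 2 ![p.1, p'.1]
      ![reflSite k c p, p'.2]) (fun p' _ hne h0 => hne (by rw [h0, mul_zero, zero_mul]))).symm]
  -- Step 2: re-index by the transposition `hat`
  let hat : (Fin 4 × Fin 4) × (Fin 4 → ℤ) → (Fin 4 × Fin 4) × (Fin 4 → ℤ) := fun p =>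
    (permPlane (Equiv.swap 0 k) p.1, sitePermZd (Equiv.swap 0 k) p.2)
  have hinj : Set.InjOn hat ↑(S.filter fun p => atomWt b {q} s y p ≠ 0) := fun p hp p' hp' h => by
    have h1 : p.1 = p'.1 := by rw [hq₀ p hp, hq₀ p' hp']
    have h2 : sitePermZd (Equiv.swap 0 k) p.2 = sitePermZd (Equiv.swap 0 k) p'.2 := (Prod.mk.inj h).2
    exact Prod.ext h1 ((sitePermZd (Equiv.swap 0 k)).injective h2)
  have hyh : (WithLp.toLp 2 fun i => y (Equiv.swap 0 k i) : EuclideanSpace ℝ (Fin 4)) =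
      WithLp.toLp 2 fun i => y (Equiv.swap 0 k i) := rfl
  have key := core_zero r hμ b hcon hT ε A hε hA ((S.filter fun p => atomWt b {q} s y p ≠ 0).image hat)
    (permPlane (Equiv.swap 0 k) q) s t (WithLp.toLp 2 fun i => y (Equiv.swap 0 k i)) c hs hAs ht ?_ ?_
  · rw [Finset.sum_image hinj] at key
    refine le_of_eq_of_le (Finset.sum_congr rfl fun p hp => ?_) key
    rw [Finset.sum_image hinj]
    refine Finset.sum_congr rfl fun p' hp' => ?_
    have ep : p = (q, p.2) := Prod.ext (hq₀ p hp) rfl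
    have ep' : p' = (q, p'.2) := Prod.ext (hq₀ p' hp') rfl
    rw [ep, ep']
    dsimp only [hat]
    rw [atomWt_perm hperm _ (Equiv.symm_swap 0 k) hq s y _ hyh p.2,
      atomWt_perm hperm _ (Equiv.symm_swap 0 k) hq s y _ hyh p'.2, ← sitePermZd_swap_reflSite k hk c q p.2,
      ← M2_swap r hμ k q q (reflSite k c (q, p.2)) p'.2]
  · -- carrier of the transposed atom
    intro ph hph
    have h1 : ph.1 = permPlane (Equiv.swap 0 k) q :=
      Finset.mem_singleton.1 ((atomWt_ne_zero_iff_flat b _ s _ ph).1 hph).1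
    have eph : ph = hat (q, sitePermZd (Equiv.swap 0 k) ph.2) :=
      Prod.ext h1 (sitePermZd_swap_swap k ph.2).symm
    rw [eph]
    rw [eph] at hph
    dsimp only [hat] at hph
    rw [atomWt_perm hperm _ (Equiv.symm_swap 0 k) hq s y _ hyh] at hph
    exact Finset.mem_image_of_mem hat ((hmem₀ _).2 ⟨hS _ hph, hph⟩)
  · -- the side of the transposed mirror
    have h20 : ∀ p : (Fin 4 × Fin 4) × (Fin 4 → ℤ), (hat p).2 0 = p.2 k := fun p => by
      show sitePermZd (Equiv.swap 0 k) p.2 0 = p.2 k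
      rw [sitePermZd_apply, Equiv.symm_swap, Equiv.swap_apply_left]
    refine hside.imp (fun h ph hph => ?_) (fun h ph hph => ?_)
    · rw [Finset.mem_image] at hph
      obtain ⟨p, hp, rfl⟩ := hph
      rw [h20]
      exact h p ((hmem₀ p).1 hp).1
    · rw [Finset.mem_image] at hph
      obtain ⟨p, hp, rfl⟩ := hph
      rw [h20]
      exact h p ((hmem₀ p).1 hp).1

/-! ## §E The registered stub E1 -/

/-- **E1 `stub_atomCeiling` PROVED (rev 2)**: `OnsetContraction → AtomCeilings`, with exactly the registered type. -/
theorem atomCeiling_proof : OnsetContraction → AtomCeilings := by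
  intro hOC G _ _ _ _ hG hSU
  letI : MeasurableSpace G := borel G
  haveI : BorelSpace G := ⟨rfl⟩
  intro r b ε β A μ hb hε hβ hμ hA S q s t y k c hq hs hAs ht hS hside
  haveI : SecondCountableTopology G := r.secondCountableTopology
  haveI : T2Space G := r.t2Space
  have hcon : Contracts r μ b := fun Q s' y' m hs' hy' =>
    hOC G hG hSU r β μ b Q s' y' m hβ hμ hb.1 hb.2.1 hs' hy'
  obtain ⟨T, hT⟩ := hb.2.2.2.2
  by_cases hk : k = 0
  · subst hk
    exact core_zero r hμ b hcon hT ε A hε hA S q s t y c hs hAs ht hS hside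
  · exact core_axis r hμ b hcon hT hb.2.2.2.1 ε A hε hA S q s t y k c hk hq hs hAs ht hS hside


/-- ★ **Registered stub E1 BY NAME + SIGNATURE** (skeletons `g15/mirror-calibration.lean`, `g15/atomic-engine.lean` of
planner ym-idea-11 on crux ⟨stmt-QuantumFields-28169⟩): `OnsetContraction → AtomCeilings`. -/
theorem stub_atomCeiling : OnsetContraction → AtomCeilings := atomCeiling_proof

/-- `AtomCeilings` holds outright: `OnsetContraction` (item 28128) is the landed
`OnsetTautologyOnsetContraction.onsetContraction_proof`. -/
theorem atomCeilings_holds : AtomCeilings :=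
  atomCeiling_proof Summit.QuantumFields.YangMills.Theorems.OnsetTautologyOnsetContraction.onsetContraction_proof

end Summit.QuantumFields.YangMills.Cruxes.AtomicCalibrationR.MirrorCalibration

end
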